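import Mathlib
import Summits.Ventures.PercRepro2.K5Transfer
import Summits.Ventures.PercRepro2.K5TypedI

/-!
# THE TYPED BASES ON EVERY SIMPLE GRAPH WITH FIVE MARKED VERTICES
(blind cell PercRepro2, typer-1 g9)

`K5Typed.lean` / `K5TypedI.lean` prove p1's typed bases `TypedII` / `TypedI` on `K₅`.  Here they are
transported to every loop-free graph without parallel edges on five marked vertices — the all-marked
instances of p2's `Reduced` class, loops aside: for `ι : V ≃ Fin 5`, `ends : E → Sym2 V` injective with
no loops, the pattern map `pattern ι ends : Config E → Config (Fin 10)` of `K5Transfer.lean` is a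
bijection from the typed triples of a minor `(F, z, τ)` of `G` onto the typed triples of the minor
`(minorF F, pattern z, minorτ τ)` of `K₅` (each pair of `K₅` carries at most one edge of `G`), and the
state kernels match along it (`KII_pattern`, `KI_pattern`), so the weight-free typed counts are EQUAL
(`typedCount_KII_eq`, `typedCount_KI_eq`) and

* **`typedII_simple`**, **`typedI_simple`**: `CaseOne.TypedII ends o a₁ a₂ a₃ b` and `CaseOne.TypedI …`
  for every such graph and marking — the all-marked, loop-free base of the (TRI) architecture of
  `(ii)` and `(i)`, in the kernel.
-/

namespace Summit.Ventures.PercRepro2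

open Hub

namespace K5

section Bundles

variable {V : Type*} {E : Type*} [Fintype E] [DecidableEq V]
variable (ι : V ≃ Fin 5) (ends : E → Sym2 V)

/-- Membership in a bundle. -/
lemma mem_bundle {e : E} {j : Fin 10} : e ∈ bundle ι ends j ↔ ends e = pairV ι j := by
  unfold bundle
  rw [Finset.mem_filter]
  exact ⟨fun h => h.2, fun h => ⟨Finset.mem_univ _, h⟩⟩

/-- Without parallel edges a bundle has at most one edge. -/
lemma bundle_eq_of_mem (hinj : Function.Injective ends) {e e' : E} {j : Fin 10}
    (he : e ∈ bundle ι ends j) (he' : e' ∈ bundle ι ends j) : e = e' :=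
  hinj (((mem_bundle ι ends).1 he).trans ((mem_bundle ι ends).1 he').symm)

/-- An edge lies in at most one bundle. -/
lemma bundle_index_unique {e : E} {j j' : Fin 10} (he : e ∈ bundle ι ends j)
    (he' : e ∈ bundle ι ends j') : j = j' := by
  by_contra h
  exact Finset.disjoint_left.1 (bundle_disjoint ι ends h) he he'

/-- A non-loop edge lies in some bundle. -/
lemma exists_bundle (hloop : ∀ e, ¬ (ends e).IsDiag) (e : E) : ∃ j, e ∈ bundle ι ends j := by
  have hd := hloop e
  generalize hs : ends e = s at hd
  induction s using Sym2.ind with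
  | _ u v =>
    rw [Sym2.mk_isDiag_iff] at hd
    obtain ⟨j, hj⟩ := exists_edge5 (ι u) (ι v) (ι.injective.ne hd)
    refine ⟨j, (mem_bundle ι ends).2 ?_⟩
    rw [hs, pairV_eq, hj, Sym2.map_mk, Equiv.symm_apply_apply, Equiv.symm_apply_apply]

/-- The pattern at a pair carrying the edge `e` is the state of `e`. -/
lemma pattern_of_mem (hinj : Function.Injective ends) {e : E} {j : Fin 10} (he : e ∈ bundle ι ends j)
    (x : Config E) : pattern ι ends x j = x e := by
  unfold pattern
  rw [Bool.eq_iff_iff, decide_eq_true_iff]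
  constructor
  · rintro ⟨e', he', hx⟩
    rwa [bundle_eq_of_mem ι ends hinj he he']
  · intro hx
    exact ⟨e, he, hx⟩

/-- The pattern at a pair carrying no edge is `false`. -/
lemma pattern_of_empty {j : Fin 10} (hj : ∀ e, e ∉ bundle ι ends j) (x : Config E) :
    pattern ι ends x j = false := by
  unfold pattern
  rw [decide_eq_false_iff_not]
  rintro ⟨e, he, -⟩
  exact hj e he

/-- Without loops and parallel edges the pattern map is injective. -/
lemma pattern_injective (hloop : ∀ e, ¬ (ends e).IsDiag) (hinj : Function.Injective ends) :
    Function.Injective (pattern ι ends) := by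
  intro x x' h
  funext e
  obtain ⟨j, he⟩ := exists_bundle ι ends hloop e
  rw [← pattern_of_mem ι ends hinj he x, ← pattern_of_mem ι ends hinj he x', h]

end Bundles

section Minors

variable {V : Type*} {E : Type*} [Fintype E] [DecidableEq E] [DecidableEq V]
variable (ι : V ≃ Fin 5) (ends : E → Sym2 V)

/-- The pairs of `K₅` whose edge lies in `F`. -/
def minorF (F : Finset E) : Finset (Fin 10) := Finset.univ.filter fun j => ∃ e ∈ F, e ∈ bundle ι ends j

/-- The type of a pair: the type of its edge (`0` on empty bundles). -/
def minorτ (τ : E → ℕ) (j : Fin 10) : ℕ := ∑ e ∈ bundle ι ends j, τ e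

/-- The configuration of `G` with the states of a `K₅`-configuration on the pairs. -/
def lift (σ : Fin 10 → Bool) : Config E := fun e => decide (∃ j, e ∈ bundle ι ends j ∧ σ j = true)

/-- Membership in `minorF`. -/
lemma mem_minorF {F : Finset E} {j : Fin 10} : j ∈ minorF ι ends F ↔ ∃ e ∈ F, e ∈ bundle ι ends j := by
  unfold minorF
  rw [Finset.mem_filter]
  exact ⟨fun h => h.2, fun h => ⟨Finset.mem_univ _, h⟩⟩

omit [DecidableEq E] in
/-- The type of a pair carrying the edge `e` is `τ e`. -/
lemma minorτ_of_mem (hinj : Function.Injective ends) {e : E} {j : Fin 10} (he : e ∈ bundle ι ends j)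
    (τ : E → ℕ) : minorτ ι ends τ j = τ e := by
  unfold minorτ
  exact Finset.sum_eq_single_of_mem e he fun e' he' hne => (hne (bundle_eq_of_mem ι ends hinj he' he)).elim

/-- The lift at an edge of the pair `j` is the state of `j`. -/
lemma lift_apply {e : E} {j : Fin 10} (he : e ∈ bundle ι ends j) (σ : Fin 10 → Bool) :
    lift ι ends σ e = σ j := by
  unfold lift
  rw [Bool.eq_iff_iff, decide_eq_true_iff]
  constructor
  · rintro ⟨j', hj', hs⟩
    rwa [bundle_index_unique ι ends he hj']
  · intro hs
    exact ⟨j, he, hs⟩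

/-- The pattern of a lift is the configuration, when it vanishes on the empty pairs. -/
lemma pattern_lift (hinj : Function.Injective ends) (σ : Fin 10 → Bool)
    (hσ : ∀ j, (∀ e, e ∉ bundle ι ends j) → σ j = false) : pattern ι ends (lift ι ends σ) = σ := by
  funext j
  by_cases hj : ∃ e, e ∈ bundle ι ends j
  · obtain ⟨e, he⟩ := hj
    rw [pattern_of_mem ι ends hinj he, lift_apply ι ends he]
  · have hj' : ∀ e, e ∉ bundle ι ends j := fun e he => hj ⟨e, he⟩
    rw [pattern_of_empty ι ends hj', hσ j hj']

end Minors

section Kernels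

variable {V : Type*} {E : Type*} [Fintype E] [DecidableEq V]
variable (ι : V ≃ Fin 5) (ends : E → Sym2 V)
variable {R : Type*} [Field R]

/-- The indicator of a preimage is the indicator of the image point. -/
lemma indicator_pattern (S : Set (Config (Fin 10))) (x : Config E) :
    (pattern ι ends ⁻¹' S).indicator (1 : Config E → R) x =
      S.indicator (1 : Config (Fin 10) → R) (pattern ι ends x) := by
  by_cases h : pattern ι ends x ∈ S
  · rw [Set.indicator_of_mem h, Set.indicator_of_mem (Set.mem_preimage.2 h)]
    rfl
  · rw [Set.indicator_of_notMem h, Set.indicator_of_notMem (fun h' => h (Set.mem_preimage.1 h'))]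

/-- **The state kernel `KII` of `G` is the state kernel of `K₅` along the pattern map.** -/
lemma KII_pattern (o a₁ a₂ a₃ b : V) (x y w : Config E) :
    CaseOne.KII (R := R) ends o a₁ a₂ a₃ b x y w =
      CaseOne.KII (R := R) ends5 (ι o) (ι a₁) (ι a₂) (ι a₃) (ι b)
        (pattern ι ends x) (pattern ι ends y) (pattern ι ends w) := by
  unfold CaseOne.KII CovForm.sepKernel CaseOne.iQ CaseOne.iA CaseOne.iQB CaseOne.iAB CaseOne.iAO
    CaseOne.iABO CaseOne.iPDc CaseOne.iPDoU
  simp only [Fin.sum_univ_succ, Fin.sum_univ_zero, Matrix.cons_val_zero, Matrix.cons_val_succ,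
    add_zero, connEvent_eq_preimage ι ends, ← Set.preimage_compl, ← Set.preimage_inter,
    ← Set.preimage_union, indicator_pattern]

/-- **The state kernel `KI` of `G` is the state kernel of `K₅` along the pattern map.** -/
lemma KI_pattern (o a₁ a₂ a₃ b : V) (x y w : Config E) :
    CaseOne.KI (R := R) ends o a₁ a₂ a₃ b x y w =
      CaseOne.KI (R := R) ends5 (ι o) (ι a₁) (ι a₂) (ι a₃) (ι b)
        (pattern ι ends x) (pattern ι ends y) (pattern ι ends w) := by
  unfold CaseOne.KI CovForm.sepKernel CaseOne.iQ CaseOne.iA CaseOne.iQB₁ CaseOne.iAB₁ CaseOne.iAO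
    CaseOne.iAB₁O CaseOne.iPDc CaseOne.iPDoU
  simp only [Fin.sum_univ_succ, Fin.sum_univ_zero, Matrix.cons_val_zero, Matrix.cons_val_succ,
    add_zero, connEvent_eq_preimage ι ends, ← Set.preimage_compl, ← Set.preimage_inter,
    ← Set.preimage_union, indicator_pattern]

end Kernels

section Counts

/-- Sums of `if`-terms over two finite types agree along a bijection of the supports (the decidability
instances are explicit, so that the lemma applies to whatever instances a goal carries). -/
lemma sum_ite_nbij {α β : Type*} [Fintype α] [Fintype β] {R : Type*} [AddCommMonoid R]
    (p : α → Prop) (q : β → Prop) (dp : DecidablePred p) (dq : DecidablePred q) (i : α → β)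
    (f : α → R) (g : β → R) (hi : ∀ a, p a → q (i a))
    (hinj : ∀ a a', p a → p a' → i a = i a' → a = a') (hsurj : ∀ b, q b → ∃ a, p a ∧ i a = b)
    (hf : ∀ a, p a → f a = g (i a)) :
    ∑ a, @ite R (p a) (dp a) (f a) 0 = ∑ b, @ite R (q b) (dq b) (g b) 0 := by
  rw [← Finset.sum_filter, ← Finset.sum_filter]
  refine Finset.sum_nbij i ?_ ?_ ?_ ?_
  · intro a ha
    rw [Finset.mem_filter] at ha ⊢
    exact ⟨Finset.mem_univ _, hi a ha.2⟩
  · intro a ha a' ha' h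
    rw [Finset.coe_filter] at ha ha'
    exact hinj a a' ha.2 ha'.2 h
  · intro b hb
    rw [Finset.coe_filter] at hb
    obtain ⟨a, ha, rfl⟩ := hsurj b hb.2
    exact ⟨a, by rw [Finset.coe_filter]; exact ⟨Finset.mem_univ _, ha⟩, rfl⟩
  · intro a ha
    rw [Finset.mem_filter] at ha
    exact hf a ha.2

variable {E : Type*} [Fintype E] [DecidableEq E] {R : Type*} [CommRing R]

/-- A typed count as one sum over the triples. -/
lemma typedCount_eq_sum_triples (F : Finset E) (z : Config E) (τ : E → ℕ)
    (K : Config E → Config E → Config E → R) :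
    typedCount F z τ K = ∑ t : Config E × Config E × Config E,
      if (∀ e, e ∉ F → t.1 e = z e ∧ t.2.1 e = z e ∧ t.2.2 e = z e) ∧
          (∀ e ∈ F, openCount t.1 t.2.1 t.2.2 e = τ e) then K t.1 t.2.1 t.2.2 else 0 := by
  unfold typedCount
  simp only [Fintype.sum_prod_type]

end Counts

section Transfer

variable {V : Type*} {E : Type*} [Fintype E] [DecidableEq E] [DecidableEq V]
variable (ι : V ≃ Fin 5) (ends : E → Sym2 V)
variable {R : Type*} [CommRing R]

/-- **The typed triples of a minor of `G` are the typed triples of a minor of `K₅`**: for any kernel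
`K` on `K₅` and its pull-back along the pattern map, the typed counts agree. -/
theorem typedCount_pattern_eq (hloop : ∀ e, ¬ (ends e).IsDiag) (hinj : Function.Injective ends)
    (K : Config (Fin 10) → Config (Fin 10) → Config (Fin 10) → R) (F : Finset E) (z : Config E)
    (τ : E → ℕ) :
    typedCount F z τ (fun x y w => K (pattern ι ends x) (pattern ι ends y) (pattern ι ends w)) =
      typedCount (minorF ι ends F) (pattern ι ends z) (minorτ ι ends τ) K := by
  rw [typedCount_eq_sum_triples, typedCount_eq_sum_triples]
  refine sum_ite_nbij _ _ _ _
    (fun t => (pattern ι ends t.1, pattern ι ends t.2.1, pattern ι ends t.2.2)) _ _ ?_ ?_ ?_ ?_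
  · rintro t ⟨hoff, hon⟩
    refine ⟨?_, ?_⟩
    · intro j hj
      by_cases hb : ∃ e, e ∈ bundle ι ends j
      · obtain ⟨e, he⟩ := hb
        have heF : e ∉ F := fun heF => hj ((mem_minorF ι ends).2 ⟨e, heF, he⟩)
        obtain ⟨h1, h2, h3⟩ := hoff e heF
        simp only [pattern_of_mem ι ends hinj he, h1, h2, h3, and_self]
      · have hb' : ∀ e, e ∉ bundle ι ends j := fun e he => hb ⟨e, he⟩
        simp only [pattern_of_empty ι ends hb', and_self]
    · intro j hj
      obtain ⟨e, heF, he⟩ := (mem_minorF ι ends).1 hj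
      rw [minorτ_of_mem ι ends hinj he, ← hon e heF]
      unfold openCount
      simp only [pattern_of_mem ι ends hinj he]
  · intro t t' _ _ h
    simp only [Prod.mk.injEq] at h
    obtain ⟨h1, h2, h3⟩ := h
    exact Prod.ext (pattern_injective ι ends hloop hinj h1)
      (Prod.ext (pattern_injective ι ends hloop hinj h2) (pattern_injective ι ends hloop hinj h3))
  · rintro t' ⟨hoff, hon⟩
    have hvan : ∀ σ ∈ ({t'.1, t'.2.1, t'.2.2} : Finset (Fin 10 → Bool)),
        ∀ j, (∀ e, e ∉ bundle ι ends j) → σ j = false := by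
      intro σ hσ j hj
      have hjF : j ∉ minorF ι ends F := fun hjF => by
        obtain ⟨e, -, he⟩ := (mem_minorF ι ends).1 hjF
        exact hj e he
      obtain ⟨h1, h2, h3⟩ := hoff j hjF
      rw [pattern_of_empty ι ends hj] at h1 h2 h3
      simp only [Finset.mem_insert, Finset.mem_singleton] at hσ
      rcases hσ with rfl | rfl | rfl
      · exact h1
      · exact h2
      · exact h3
    refine ⟨(lift ι ends t'.1, lift ι ends t'.2.1, lift ι ends t'.2.2), ⟨?_, ?_⟩, ?_⟩
    · intro e heF
      obtain ⟨j, he⟩ := exists_bundle ι ends hloop e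
      have hjF : j ∉ minorF ι ends F := fun hjF => by
        obtain ⟨e', he'F, he'⟩ := (mem_minorF ι ends).1 hjF
        exact heF (bundle_eq_of_mem ι ends hinj he' he ▸ he'F)
      obtain ⟨h1, h2, h3⟩ := hoff j hjF
      rw [pattern_of_mem ι ends hinj he] at h1 h2 h3
      simp only [lift_apply ι ends he, h1, h2, h3, and_self]
    · intro e heF
      obtain ⟨j, he⟩ := exists_bundle ι ends hloop e
      have hjF : j ∈ minorF ι ends F := (mem_minorF ι ends).2 ⟨e, heF, he⟩
      have := hon j hjF
      rw [minorτ_of_mem ι ends hinj he] at this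
      rw [← this]
      unfold openCount
      simp only [lift_apply ι ends he]
    · simp only
      rw [pattern_lift ι ends hinj _ (hvan _ (by simp)), pattern_lift ι ends hinj _ (hvan _ (by simp)),
        pattern_lift ι ends hinj _ (hvan _ (by simp))]
  · intro t _
    rfl

end Transfer

section Theorems

variable {V : Type*} {E : Type*} [Fintype E] [DecidableEq E] [DecidableEq V]
variable (ι : V ≃ Fin 5) (ends : E → Sym2 V)
variable {R : Type*} [Field R] [LinearOrder R] [IsStrictOrderedRing R]

omit [LinearOrder R] [IsStrictOrderedRing R] in
/-- The typed counts of `KII` on `G` are typed counts of `KII` on `K₅`. -/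
theorem typedCount_KII_eq (hloop : ∀ e, ¬ (ends e).IsDiag) (hinj : Function.Injective ends)
    (o a₁ a₂ a₃ b : V) (F : Finset E) (z : Config E) (τ : E → ℕ) :
    typedCount F z τ (CaseOne.KII (R := R) ends o a₁ a₂ a₃ b) =
      typedCount (minorF ι ends F) (pattern ι ends z) (minorτ ι ends τ)
        (CaseOne.KII (R := R) ends5 (ι o) (ι a₁) (ι a₂) (ι a₃) (ι b)) := by
  rw [← typedCount_pattern_eq ι ends hloop hinj]
  congr 1
  funext x y w
  exact KII_pattern ι ends o a₁ a₂ a₃ b x y w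

omit [LinearOrder R] [IsStrictOrderedRing R] in
/-- The typed counts of `KI` on `G` are typed counts of `KI` on `K₅`. -/
theorem typedCount_KI_eq (hloop : ∀ e, ¬ (ends e).IsDiag) (hinj : Function.Injective ends)
    (o a₁ a₂ a₃ b : V) (F : Finset E) (z : Config E) (τ : E → ℕ) :
    typedCount F z τ (CaseOne.KI (R := R) ends o a₁ a₂ a₃ b) =
      typedCount (minorF ι ends F) (pattern ι ends z) (minorτ ι ends τ)
        (CaseOne.KI (R := R) ends5 (ι o) (ι a₁) (ι a₂) (ι a₃) (ι b)) := by
  rw [← typedCount_pattern_eq ι ends hloop hinj]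
  congr 1
  funext x y w
  exact KI_pattern ι ends o a₁ a₂ a₃ b x y w

/-- **THE TYPED `(ii)` ON EVERY LOOP-FREE GRAPH WITHOUT PARALLEL EDGES ON FIVE MARKED VERTICES.** -/
theorem typedII_simple (hloop : ∀ e, ¬ (ends e).IsDiag) (hinj : Function.Injective ends)
    (o a₁ a₂ a₃ b : V) (h₀ : ι o = 0) (h₁ : ι a₁ = 1) (h₂ : ι a₂ = 2) (h₃ : ι a₃ = 3) (h₄ : ι b = 4) :
    CaseOne.TypedII (R := R) ends o a₁ a₂ a₃ b := by
  intro q G σ hq hpin _hσ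
  rw [triSum_pinned_eq q G hpin σ]
  refine mul_nonneg (prod_typed_factors_nonneg q hq G σ) ?_
  rw [typedCount_KII_eq ι ends hloop hinj, h₀, h₁, h₂, h₃, h₄]
  exact typedCount_KII_nonneg _ _ _

/-- **THE TYPED `(i)` ON EVERY LOOP-FREE GRAPH WITHOUT PARALLEL EDGES ON FIVE MARKED VERTICES.** -/
theorem typedI_simple (hloop : ∀ e, ¬ (ends e).IsDiag) (hinj : Function.Injective ends)
    (o a₁ a₂ a₃ b : V) (h₀ : ι o = 0) (h₁ : ι a₁ = 1) (h₂ : ι a₂ = 2) (h₃ : ι a₃ = 3) (h₄ : ι b = 4) :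
    CaseOne.TypedI (R := R) ends o a₁ a₂ a₃ b := by
  intro q G σ hq hpin _hσ
  rw [triSum_pinned_eq q G hpin σ]
  refine mul_nonneg (prod_typed_factors_nonneg q hq G σ) ?_
  rw [typedCount_KI_eq ι ends hloop hinj, h₀, h₁, h₂, h₃, h₄]
  exact typedCount_KI_nonneg _ _ _

end Theorems

end K5

end Summit.Ventures.PercRepro2
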